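import Summits.QuantumFields.YangMills.Theorems.FluctuationComparisonRegPrIntLOrganTangentLogDensityPathLipOfBeta
import Summits.QuantumFields.YangMills.Theorems.FluctuationComparisonRegPrIntLOrganTangentTopDisplacementLipOfHdisp
import HarnessLib

/-!
# Crux `FluctuationComparisonRegPrIntL` (stmt-QuantumFields-20520, rung R3), PATH-B organ, H-currency cone — (L42a) «SEGMENT EDITION, DENSITY SIDE»: path-Lipschitz of an
# analytic-window functional ALONG IN-WINDOW PARAMETER SEGMENTS from (β) + LOCAL bondwise exponential increments (any locality radius `δ > 0`) — the smallness rows of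
# ✓(L40) `…OrganTangentLogDensityPathLipOfBeta` decouple from the segment length

Cell `ym3-torus` (YM ladder rung R3 = continuum `SU(2)` Yang–Mills on the three-torus — a RUNG: NOT d = 4, NOT infinite volume, NOT a mass gap, NOT Clay).
Width seat `ym-ust-20520-w5` (gen 25), `--kind proof --supports stmt-QuantumFields-20520 --as helper`, count-neutral, DEFINITION-FREE, default heartbeats,
no registry ∕ binder ∕ `Lines/` edit.  Over ✓p822939 `…LogDensityPathLipOfBeta` (`abs_sub_le_of_beta_of_incr`, `plaqSmall_piecewise_of_incr`), ✓p823035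
`…TopDisplacementLipOfHdisp` (`lipschitzOnWith_of_local`), ✓`…OrganTangentGradientFromAnalytic` (`analyticPairWindowAt_bound_nonneg`).

WHY.  ✓(L40) asks the increment letter (Φ-bond-incr) for ALL parameter pairs of the sub-window set `S` (diameter up to 3), so its smallness rows read `3·k_e ≤ μ < r·θ` — the
chart's bond speed is coupled to the (β) radius.  But the REG′ consumer (the support product rule of ✓(L39a)) only ever needs the density factor between two support points
JOINED BY AN IN-SUPPORT SEGMENT (between two components of the cut's support sits a zero of the cut — see ✓(L42b)), and along a segment a LOCAL increment letter
(pairs at distance `≤ δ`, any `δ > 0`) suffices by equal subdivision (✓`lipschitzOnWith_of_local`).  The rows become «`k_e·δ ≤ μ`, `θ₁ + 4·(√3·μ) ≤ θ`, `μ < r·θ`» — for a given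
chart speed pick `δ` small: no coupling.

WHAT.  §1 ★★`abs_sub_le_of_beta_of_localIncr_seg`: for `f` with the (β) text (window `θ`, radius `r·θ`, bound `B`; binder VERBATIM as ✓`firstDiff_of_analyticPairWindowAt`), a fine
curve `c` on a CONVEX parameter set `I` with the LOCAL letter (Φ-bond-incr-loc) «`∀ s s′ ∈ I, |s − s′| ≤ δ → ∀ e, ∃ w, c s′ e = c s e·expPt w ∧ ‖w‖ ≤ k e·|s − s′|`», `Σ_e k e ≤ K`,
`k e·δ ≤ μ`, `θ₁ + 4·(√3·μ) ≤ θ`, `μ < r·θ`: for every `x, y ∈ I` whose segment `uIcc x y` lies in `{s | PlaqSmall θ₁ (c s)}`, `|f (c x) − f (c y)| ≤ (B∕r)·(K∕θ)·|x − y|`.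
§2 ★★`logDensity_segLip_of_beta`: the organ reading (`f := log ρT` with the row-prefix (β) at level `Ts`, `θ₁ := 24∕25·θ_Ts`, `I := Ioo (-1) 2`, curve `s ↦ Φ (X s, z)`): the
SEGMENT form of the (logρ-Lip) letter — `∀ x y ∈ Ioo (-1) 2, (∀ r ∈ uIcc x y, PlaqSmall (24∕25·θ_Ts) (Φ (X r, z))) → |log ρT (Φ (X x, z)) − log ρT (Φ (X y, z))| ≤ (BρT∕rA)·(K∕(49∕50·θ_Ts))·|x − y|`
— consumed by ✓(L42b) `…OrganTangentWeightLipOfChartLettersSeg`.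

HONEST FRAMING: [folklore] subdivision bookkeeping over HYPOTHESIS letters; (β) is a run-prefix HYPOTHESIS, (Φ-bond-incr-loc) D0 chart material; nothing of Bałaban's analysis is
asserted or proved; KER′, (I-curv), (I-cov), `hdisp`, `hdisp_n`, (J-Lip) untouched and OPEN; `OrganDischargeInputsHJ(sq)` ∕ `SpreadFibreLawH(J)(sq)` UNDISCHARGED; the five registered
stubs of `Lines/semiclassical_s2beta.lean`, crux 20520 and `YM3TorusSU2` are NOT proved; registry untouched; rung R3 = SU(2) YM₃ on T³ — NOT d = 4, NOT infinite volume, NOT a mass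
gap, NOT Clay; the Yang–Mills mass gap is NOT proved.  [folklore]
-/

set_option autoImplicit false

noncomputable section

namespace Summit.QuantumFields.YangMills.Theorems.OrganTangentLogDensitySegLipOfBeta

open Set Function Metric
open scoped NNReal BigOperators
open Literature.MathematicalPhysics.QuantumFieldTheory.Balaban1983to89 T3ContinuumYM3Torus T3NestedUnitLaws
  T3UnitLawDensityEML T4Continuum BalabanUVClass T3UnitScaleTilt
open T4CubeChartExp (expPt)
open Summit.QuantumFields.YangMills.Theorems.OrganTangentGradientFromAnalytic (analyticPairWindowAt_bound_nonneg)
open Summit.QuantumFields.YangMills.Theorems.OrganTangentLogDensityPathLipOfBeta (abs_sub_le_of_beta_of_incr plaqSmall_piecewise_of_incr)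
open Summit.QuantumFields.YangMills.Theorems.OrganTangentTopDisplacementLipOfHdisp (lipschitzOnWith_of_local)

/-! ## §1 Along an in-window parameter segment: (β) + LOCAL bondwise increments -/

section Seg

variable {P : Params} {j : ℕ}

/-- ★★ **SEGMENT BOUND FROM (β) + LOCAL INCREMENTS**: see the module docstring (speeds `k e ≥ 0`; the constant is read through `toNNReal`, which is the identity on the
relevant non-negative value whenever the bond type is non-empty). [folklore] -/
theorem abs_sub_le_of_beta_of_localIncr_seg (θ r B : ℝ) (hθ : 0 < θ) (hr : 0 < r)
    (f : GaugeField P j ↥(Matrix.specialUnitaryGroup (Fin 2) ℂ) → ℝ)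
    (hβ : ∀ (U : GaugeField P j ↥(Matrix.specialUnitaryGroup (Fin 2) ℂ)), PlaqSmall θ U →
      ∀ (b b' : PBond P j) (v v' : Fin 3 → ℝ), ‖v‖ ≤ 1 → ‖v'‖ ≤ 1 →
        ∃ g : ℂ × ℂ → ℂ, DifferentiableOn ℂ g (Metric.ball (0 : ℂ) (r * θ) ×ˢ Metric.ball (0 : ℂ) (r * θ)) ∧
          (∀ (s t : ℝ) (V Z : GaugeField P j ↥(Matrix.specialUnitaryGroup (Fin 2) ℂ)), |s| < r * θ → |t| < r * θ →
            (∀ e, e ≠ b → V e = U e) → V b = U b * expPt (s • v) → (∀ e, e ≠ b' → Z e = V e) → Z b' = V b' * expPt (t • v') →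
            g ((s : ℂ), (t : ℂ)) = ((f Z : ℝ) : ℂ)) ∧
          ∀ z ∈ Metric.ball (0 : ℂ) (r * θ) ×ˢ Metric.ball (0 : ℂ) (r * θ), ‖g z - g 0‖ ≤ B)
    {θ₁ μ K δ : ℝ} (hδ : 0 < δ) (c : ℝ → GaugeField P j ↥(Matrix.specialUnitaryGroup (Fin 2) ℂ)) (I : Set ℝ) (hI : Convex ℝ I)
    (k : PBond P j → ℝ) (hk0 : ∀ e, 0 ≤ k e) (hK : ∑ e, k e ≤ K) (hkμ : ∀ e, k e * δ ≤ μ)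
    (hincr : ∀ s ∈ I, ∀ s' ∈ I, |s - s'| ≤ δ → ∀ e, ∃ w : Fin 3 → ℝ, c s' e = c s e * expPt w ∧ ‖w‖ ≤ k e * |s - s'|)
    (hwin : θ₁ + 4 * (Real.sqrt 3 * μ) ≤ θ) (hrad : μ < r * θ) :
    ∀ x ∈ I, ∀ y ∈ I, (∀ r' ∈ Set.uIcc x y, PlaqSmall θ₁ (c r')) →
      |f (c x) - f (c y)| ≤ (Real.toNNReal ((B / r) * (K / θ)) : ℝ) * |x - y| := by
  classical
  intro x hx y hy hseg
  -- the parameter segment, a convex subset of `I` inside the `θ₁`-window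
  set I' : Set ℝ := I ∩ Set.uIcc x y with hI'
  have hI'c : Convex ℝ I' := hI.inter (convex_uIcc x y)
  set n : ℕ := ⌈|x - y| / δ⌉₊ + 1 with hn
  have hn0 : 0 < n := Nat.succ_pos _
  have hdiam : ∀ a ∈ I', ∀ b ∈ I', |a - b| ≤ n * δ := by
    intro a ha b hb
    have hab : |b - a| ≤ |y - x| := Set.abs_sub_le_of_uIcc_subset_uIcc (Set.uIcc_subset_uIcc ha.2 hb.2)
    rw [abs_sub_comm b a, abs_sub_comm y x] at hab
    have h1 : |x - y| / δ ≤ ⌈|x - y| / δ⌉₊ := Nat.le_ceil _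
    have h2 : |x - y| ≤ (⌈|x - y| / δ⌉₊ : ℝ) * δ := by rwa [div_le_iff₀ hδ] at h1
    calc |a - b| ≤ |x - y| := hab
      _ ≤ (⌈|x - y| / δ⌉₊ : ℝ) * δ := h2
      _ ≤ n * δ := by rw [hn]; push_cast; nlinarith
  have hlip : LipschitzOnWith (Real.toNNReal ((B / r) * (K / θ))) (fun s => f (c s)) I' := by
    refine lipschitzOnWith_of_local hI'c δ n hn0 hdiam fun a ha b hb hab => ?_
    rcases isEmpty_or_nonempty (PBond P j) with hE | ⟨⟨e₀⟩⟩
    · have hcc : c a = c b := funext fun e => (hE.false e).elim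
      rw [hcc, sub_self, abs_zero]; positivity
    -- the local increments from `c b` to `c a`
    have hba : |b - a| ≤ δ := by rw [abs_sub_comm]; exact hab
    choose w hw using fun e => hincr b hb.1 a ha.1 hba e
    have hμe : ∀ e, ‖w e‖ ≤ μ := fun e => (hw e).2.trans ((mul_le_mul_of_nonneg_left hba (hk0 e)).trans (hkμ e))
    have hcb : PlaqSmall θ₁ (c b) := hseg b hb.2
    have hmain := abs_sub_le_of_beta_of_incr θ r B hθ hr f hβ hcb w (fun e => (hw e).1) hμe hwin hrad
    have hμ0 : 0 ≤ μ := le_trans (mul_nonneg (hk0 e₀) hδ.le) (hkμ e₀)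
    have hcbθ : PlaqSmall θ (c b) := fun p => lt_of_lt_of_le (hcb p) (by nlinarith [Real.sqrt_nonneg 3])
    have hB0 : 0 ≤ B := analyticPairWindowAt_bound_nonneg θ r B hθ hr f hβ (c b) hcbθ e₀
    have hc0 : 0 ≤ (B / r) / θ := by positivity
    have hsum : ∑ e, ‖w e‖ ≤ K * |a - b| := by
      calc ∑ e, ‖w e‖ ≤ ∑ e, k e * |b - a| := Finset.sum_le_sum fun e _ => (hw e).2
        _ = (∑ e, k e) * |a - b| := by rw [Finset.sum_mul, abs_sub_comm]
        _ ≤ K * |a - b| := mul_le_mul_of_nonneg_right hK (abs_nonneg _)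
    calc |f (c a) - f (c b)| ≤ (B / r) / θ * ∑ e, ‖w e‖ := hmain
      _ ≤ (B / r) / θ * (K * |a - b|) := mul_le_mul_of_nonneg_left hsum hc0
      _ = ((B / r) * (K / θ)) * |a - b| := by ring
      _ ≤ (Real.toNNReal ((B / r) * (K / θ)) : ℝ) * |a - b| := mul_le_mul_of_nonneg_right (Real.le_coe_toNNReal _) (abs_nonneg _)
  have h := (lipschitzOnWith_iff_dist_le_mul.1 hlip) x ⟨hx, Set.left_mem_uIcc⟩ y ⟨hy, Set.right_mem_uIcc⟩
  rwa [Real.dist_eq, Real.dist_eq] at h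

end Seg

/-! ## §2 The organ reading: the SEGMENT form of (logρ-Lip) from the row's (β) at level `Ts` + LOCAL increments -/

section Organ

/-- ★★ **(logρ-Lip), SEGMENT FORM, FROM (β) + (Φ-bond-incr-loc)** — for a level-`Ts` density `ρT` carrying the row's (β) text at level `Ts` (window `49∕50·θ_Ts`, radius
`rA·(49∕50·θ_Ts)`, bound `BρT`), a fibred chart `Φ`, a coarse curve `X`, a fibre point `z`, and LOCAL bondwise exponential increments of `s ↦ Φ (X s, z)` on `Ioo (-1) 2` (pairs at
distance `≤ δ`, speeds `k ≥ 0`, `Σ k ≤ K`, `k e·δ ≤ μ`, `4·(√3·μ) ≤ θ_Ts∕50`, `μ < rA·(49∕50·θ_Ts)`): for all `x, y ∈ Ioo (-1) 2` whose segment stays in the `24∕25·θ_Ts`-window,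
`|log ρT (Φ (X x, z)) − log ρT (Φ (X y, z))| ≤ toNNReal ((BρT∕rA)·(K∕(49∕50·θ_Ts)))·|x − y|`. [folklore] -/
theorem logDensity_segLip_of_beta (F : T3Family) (γ b₀ p₀ : ℝ) (j Ts : ℕ)
    (ρT : GaugeField (F.P Ts) 0 ↥(Matrix.specialUnitaryGroup (Fin 2) ℂ) → ℝ) (rA BρT : ℝ) (hrA : 0 < rA) (hθT : 0 < θBal F.L γ b₀ p₀ Ts)
    (hβ : ∀ (U : GaugeField (F.P Ts) 0 ↥(Matrix.specialUnitaryGroup (Fin 2) ℂ)), PlaqSmall (49 / 50 * θBal F.L γ b₀ p₀ Ts) U →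
      ∀ (b b' : PBond (F.P Ts) 0) (v v' : Fin 3 → ℝ), ‖v‖ ≤ 1 → ‖v'‖ ≤ 1 →
        ∃ g : ℂ × ℂ → ℂ, DifferentiableOn ℂ g (Metric.ball (0 : ℂ) (rA * (49 / 50 * θBal F.L γ b₀ p₀ Ts)) ×ˢ Metric.ball (0 : ℂ) (rA * (49 / 50 * θBal F.L γ b₀ p₀ Ts))) ∧
          (∀ (s t : ℝ) (V Z : GaugeField (F.P Ts) 0 ↥(Matrix.specialUnitaryGroup (Fin 2) ℂ)), |s| < rA * (49 / 50 * θBal F.L γ b₀ p₀ Ts) → |t| < rA * (49 / 50 * θBal F.L γ b₀ p₀ Ts) →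
            (∀ e, e ≠ b → V e = U e) → V b = U b * expPt (s • v) → (∀ e, e ≠ b' → Z e = V e) → Z b' = V b' * expPt (t • v') →
            g ((s : ℂ), (t : ℂ)) = (((Real.log (ρT Z)) : ℝ) : ℂ)) ∧
          ∀ z ∈ Metric.ball (0 : ℂ) (rA * (49 / 50 * θBal F.L γ b₀ p₀ Ts)) ×ˢ Metric.ball (0 : ℂ) (rA * (49 / 50 * θBal F.L γ b₀ p₀ Ts)), ‖g z - g 0‖ ≤ BρT)
    {Z : Type} (Φ : GaugeField (F.P j) 0 ↥(Matrix.specialUnitaryGroup (Fin 2) ℂ) × Z → GaugeField (F.P Ts) 0 ↥(Matrix.specialUnitaryGroup (Fin 2) ℂ))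
    (X : ℝ → GaugeField (F.P j) 0 ↥(Matrix.specialUnitaryGroup (Fin 2) ℂ)) (z : Z) {μ K δ : ℝ} (hδ : 0 < δ)
    (k : PBond (F.P Ts) 0 → ℝ) (hk0 : ∀ e, 0 ≤ k e) (hK : ∑ e, k e ≤ K) (hkμ : ∀ e, k e * δ ≤ μ)
    (hincr : ∀ s ∈ Set.Ioo (-1 : ℝ) 2, ∀ s' ∈ Set.Ioo (-1 : ℝ) 2, |s - s'| ≤ δ →
      ∀ e, ∃ w : Fin 3 → ℝ, Φ (X s', z) e = Φ (X s, z) e * expPt w ∧ ‖w‖ ≤ k e * |s - s'|)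
    (hwin : 4 * (Real.sqrt 3 * μ) ≤ θBal F.L γ b₀ p₀ Ts / 50) (hrad : μ < rA * (49 / 50 * θBal F.L γ b₀ p₀ Ts)) :
    ∀ x ∈ Set.Ioo (-1 : ℝ) 2, ∀ y ∈ Set.Ioo (-1 : ℝ) 2, (∀ r' ∈ Set.uIcc x y, PlaqSmall (24 / 25 * θBal F.L γ b₀ p₀ Ts) (Φ (X r', z))) →
      |Real.log (ρT (Φ (X x, z))) - Real.log (ρT (Φ (X y, z)))| ≤ (Real.toNNReal ((BρT / rA) * (K / (49 / 50 * θBal F.L γ b₀ p₀ Ts))) : ℝ) * |x - y| :=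
  abs_sub_le_of_beta_of_localIncr_seg (49 / 50 * θBal F.L γ b₀ p₀ Ts) rA BρT (by positivity) hrA (fun Z => Real.log (ρT Z)) hβ hδ
    (fun s => Φ (X s, z)) _ (convex_Ioo (-1 : ℝ) 2) k hk0 hK hkμ hincr (by linarith) hrad

end Organ


end Summit.QuantumFields.YangMills.Theorems.OrganTangentLogDensitySegLipOfBeta

end
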